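import Summits.AnomalousDissipation.AnomalousDissipation.Theorems.SawtoothPulseCascadeK1LocalisedCascadeKHLineKernelFourier

/-!
# K2 lane (route-2 `SawtoothPulseCascade`, crux dir `K1LocalisedCascade`): the single-mode FORCING of the kink-sheet block in closed form

Helper file of the K2 lane (ACL item stmt-AnomalousDissipation-19491), the first step of the FORCED part of S2-cert (A26-4 (a); p4's `forcing` in
`K2TypedSlotMap.lean` / `K2ConeSketch.lean` §0). In an H slot of strain `s`, interior content `e^{2πiξy}` of the family `(a, β)` (`ξ = β + n`) is transported to
`e^{2πiξy} e^{−2πi a s T(y)}` (`T = triWave`) and induces on the kink line `y₀ ∈ {¼, −¼}` the stream-function value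
`src(y₀, s) = ∫_{−½}^{½} G_{a,β}(y₀ − y) e^{2πiξy} e^{−2πi a s T(y)} dy`, `G` the periodised line kernel (quasi-periodic: `G(u) = e^{2πiβ⌊u⌋} K(u − ⌊u⌋)`,
`K(r) = −(e^{−κr}/(1 − z̄q) + z e^{κ(r−1)}/(1 − zq))/(2κ)` on `[0,1)`, `κ = 2πa`, `z = e^{2πiβ}`, `q = e^{−κ}`). Since `T` is linear on the three pieces
`[−½,−¼]`, `[−¼,¼]`, `[¼,½]` (slopes `−1, +1, −1`) and `G(y₀ − ·)` is a two-term exponential on each, **`src(y₀, s)` is an explicit six-term sum of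
`(e^{λy₂} − e^{λy₁})/λ`, `λ = ±κ + 2πi(ξ ± a s)`**, carrying the phases `e^{+iπas}`, `1`, `e^{−iπas}` of the trough line, the centre strip and the crest line
(assembled in the sequel `…KHForcingClosedForm`: `forcing_src_quarter`, `forcing_src_negQuarter`; this file: the six piecewise integrand identities
`forcingIntegrand_quarter_trough/centre/crest`, `forcingIntegrand_negQuarter_trough/centre/crest`). This is the input of every forced-response estimate (P3 comb event, P1″ stable-block creation: the
kink phases `e^{∓iπas}·e^{±…}` against the block frequency `≈ πa/2 − 1` give p4's detuning `1`).
Ingredients: `hKr` (the kernel on `[0,1)` as `A e^{−κr} + B e^{κr}`), floor values of `y₀ − y` and the three linear pieces of `triWave` (tree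
`triWave_eq_self`, `triWave_eq_half_sub`, `triWave_add_one`), the generic piece integral `integral_twoExp_mul_cexp`.
No definitions; no statement about the crux. [cite: Drazin2002, §8.3 (8.36)–(8.38)] [problem: turb]
-/

-- `Summit.<Summit>.<Problem>`: single-conjunct summit, the duplicate namespace segment is deliberate.
set_option linter.dupNamespace false

noncomputable section

namespace Summit.AnomalousDissipation.AnomalousDissipation.Theorems.SawtoothPulseCascade.K2PhaseBudget

open Set MeasureTheory intervalIntegral Literature.Analysis.FluidPDE.SawtoothCascade

/-! ## §1 The generic piece integral -/

/-- `∫_{y₁}^{y₂} (c₁ e^{κy} + c₂ e^{−κy}) e^{iνy} dy = c₁ (e^{λ₊y₂} − e^{λ₊y₁})/λ₊ + c₂ (e^{λ₋y₂} − e^{λ₋y₁})/λ₋`, `λ± = ±κ + iν` (`κ ≠ 0` real, `ν` real).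
[folklore] -/
theorem integral_twoExp_mul_cexp (c₁ c₂ : ℂ) {κ : ℝ} (hκ : κ ≠ 0) (ν y₁ y₂ : ℝ) :
    ∫ y in y₁..y₂, (c₁ * Complex.exp ((κ : ℂ) * y) + c₂ * Complex.exp (-(κ : ℂ) * y)) * Complex.exp ((ν : ℂ) * y * Complex.I) =
      c₁ * ((Complex.exp (((κ : ℂ) + ν * Complex.I) * y₂) - Complex.exp (((κ : ℂ) + ν * Complex.I) * y₁)) / ((κ : ℂ) + ν * Complex.I)) +
      c₂ * ((Complex.exp ((-(κ : ℂ) + ν * Complex.I) * y₂) - Complex.exp ((-(κ : ℂ) + ν * Complex.I) * y₁)) / (-(κ : ℂ) + ν * Complex.I)) := by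
  have h1 : ((κ : ℂ) + ν * Complex.I) ≠ 0 := by
    intro h; have := congrArg Complex.re h; simp at this; exact hκ this
  have h2 : (-(κ : ℂ) + ν * Complex.I) ≠ 0 := by
    intro h; have := congrArg Complex.re h; simp at this; exact hκ this
  have e : ∀ y : ℝ, (c₁ * Complex.exp ((κ : ℂ) * y) + c₂ * Complex.exp (-(κ : ℂ) * y)) * Complex.exp ((ν : ℂ) * y * Complex.I) =
      c₁ * Complex.exp (((κ : ℂ) + ν * Complex.I) * y) + c₂ * Complex.exp ((-(κ : ℂ) + ν * Complex.I) * y) := by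
    intro y
    have f1 : Complex.exp ((κ : ℂ) * y) * Complex.exp ((ν : ℂ) * y * Complex.I) = Complex.exp (((κ : ℂ) + ν * Complex.I) * y) := by
      rw [← Complex.exp_add]; congr 1; ring
    have f2 : Complex.exp (-(κ : ℂ) * y) * Complex.exp ((ν : ℂ) * y * Complex.I) = Complex.exp ((-(κ : ℂ) + ν * Complex.I) * y) := by
      rw [← Complex.exp_add]; congr 1; ring
    rw [← f1, ← f2]; ring
  simp_rw [e]
  rw [intervalIntegral.integral_add, intervalIntegral.integral_const_mul, intervalIntegral.integral_const_mul,
    integral_exp_mul_complex h1, integral_exp_mul_complex h2]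
  · exact ((Complex.continuous_exp.comp (continuous_const.mul Complex.continuous_ofReal)).const_mul _).intervalIntegrable _ _
  · exact ((Complex.continuous_exp.comp (continuous_const.mul Complex.continuous_ofReal)).const_mul _).intervalIntegrable _ _

/-! ## §2 The kernel on one period as two exponentials; floors; the pieces of the triangle wave -/

section pieces

variable {a β : ℝ} {K G : ℝ → ℂ}

/-- On `[0,1)` the kernel is `K(r) = A e^{−κr} + B e^{κr}` with `A = −1/((1 − z̄q)2κ)`, `B = −zq/((1 − zq)2κ)`. [cite: Drazin2002, §8.3 (8.36)–(8.38)] -/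
theorem lineKernel_twoExp (ha : 0 < a) (β : ℝ)
    (hK : K = fun r : ℝ => (-((Real.exp (-(2 * Real.pi * a * r)) : ℂ) /
            (1 - starRingEnd ℂ (Complex.exp (2 * Real.pi * β * Complex.I)) * (Real.exp (-(2 * Real.pi * a)) : ℂ))
          + (Real.exp (2 * Real.pi * a * (r - 1)) : ℂ) * Complex.exp (2 * Real.pi * β * Complex.I) /
            (1 - Complex.exp (2 * Real.pi * β * Complex.I) * (Real.exp (-(2 * Real.pi * a)) : ℂ))) /
        (2 * (2 * Real.pi * a) : ℂ))) (r : ℝ) :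
    K r = (-1 / ((1 - starRingEnd ℂ (Complex.exp (2 * Real.pi * β * Complex.I)) * (Real.exp (-(2 * Real.pi * a)) : ℂ)) * (2 * (2 * Real.pi * a)))) *
        Complex.exp (-((2 * Real.pi * a : ℝ) : ℂ) * r) +
      (-(Complex.exp (2 * Real.pi * β * Complex.I) * (Real.exp (-(2 * Real.pi * a)) : ℂ)) /
          ((1 - Complex.exp (2 * Real.pi * β * Complex.I) * (Real.exp (-(2 * Real.pi * a)) : ℂ)) * (2 * (2 * Real.pi * a)))) *
        Complex.exp (((2 * Real.pi * a : ℝ) : ℂ) * r) := by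
  have hzn : ‖Complex.exp (2 * Real.pi * β * Complex.I)‖ = 1 := by
    rw [show (2 * Real.pi * β * Complex.I : ℂ) = ((2 * Real.pi * β : ℝ) : ℂ) * Complex.I by push_cast; ring]
    exact Complex.norm_exp_ofReal_mul_I _
  have hq0 : 0 < Real.exp (-(2 * Real.pi * a)) := Real.exp_pos _
  have hq1 : Real.exp (-(2 * Real.pi * a)) < 1 := Real.exp_lt_one_iff.2 (by nlinarith [Real.pi_pos])
  have hd1 := one_sub_mul_ne_zero (by rw [Complex.norm_conj]; exact hzn) hq0.le hq1
  have hd2 := one_sub_mul_ne_zero hzn hq0.le hq1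
  have hκ : (2 * (2 * Real.pi * a) : ℂ) ≠ 0 := by
    have : (0:ℝ) < 2 * (2 * Real.pi * a) := by positivity
    exact_mod_cast this.ne'
  have e1 : (Real.exp (-(2 * Real.pi * a * r)) : ℂ) = Complex.exp (-((2 * Real.pi * a : ℝ) : ℂ) * r) := by
    rw [Complex.ofReal_exp]; congr 1; push_cast; ring
  have e2 : (Real.exp (2 * Real.pi * a * (r - 1)) : ℂ) = (Real.exp (-(2 * Real.pi * a)) : ℂ) * Complex.exp (((2 * Real.pi * a : ℝ) : ℂ) * r) := by
    rw [Complex.ofReal_exp, Complex.ofReal_exp, ← Complex.exp_add]; congr 1; push_cast; ring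
  rw [hK]; dsimp only
  rw [e1, e2]
  field_simp
  ring

/-- `⌊u⌋ = 0` on `[0,1)` and `⌊u⌋ = −1` on `[−1,0)`. [folklore] -/
theorem floor_eq_zero_of_mem {u : ℝ} (h0 : 0 ≤ u) (h1 : u < 1) : ⌊u⌋ = 0 :=
  Int.floor_eq_iff.2 ⟨by simpa using h0, by simpa using h1⟩

/-- `⌊u⌋ = −1` on `[−1,0)`. [folklore] -/
theorem floor_eq_neg_one_of_mem {u : ℝ} (h0 : -1 ≤ u) (h1 : u < 0) : ⌊u⌋ = -1 :=
  Int.floor_eq_iff.2 ⟨by simpa using h0, by simpa using h1⟩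

/-- The trough piece: `triWave y = −½ − y` on `[−¾, −¼]`. [cite: ElgindiLissMattingly2025, §1 (H_α, V_α)] -/
theorem triWave_eq_neg_half_sub {y : ℝ} (h₁ : -(3 / 4) ≤ y) (h₂ : y ≤ -(1 / 4)) : triWave y = -(1 / 2) - y := by
  rw [← triWave_add_one y, triWave_eq_half_sub (by linarith) (by linarith)]; ring

end pieces

/-! ## §3 The integrand on the three pieces, for the two kink lines -/

section forcing

variable {a : ℝ} {K G : ℝ → ℂ}

/-- Piece `quarter_trough`: on `Ioo (-(1 / 2 : ℝ)) (-(1 / 4 : ℝ))` the single-mode forcing integrand at the kink line `y₀ = (1 / 4 : ℝ)` is an explicit two-exponential times a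
linear phase (floor of `y₀ − y` is `0`, `triWave` is linear there). [cite: Drazin2002, §8.3 (8.36)–(8.38)] -/
theorem forcingIntegrand_quarter_trough (ha : 0 < a) (β ξ s : ℝ)
    (hK : K = fun r : ℝ => (-((Real.exp (-(2 * Real.pi * a * r)) : ℂ) /
            (1 - starRingEnd ℂ (Complex.exp (2 * Real.pi * β * Complex.I)) * (Real.exp (-(2 * Real.pi * a)) : ℂ))
          + (Real.exp (2 * Real.pi * a * (r - 1)) : ℂ) * Complex.exp (2 * Real.pi * β * Complex.I) /
            (1 - Complex.exp (2 * Real.pi * β * Complex.I) * (Real.exp (-(2 * Real.pi * a)) : ℂ))) /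
        (2 * (2 * Real.pi * a) : ℂ)))
    (hG : ∀ u : ℝ, G u = Complex.exp (2 * Real.pi * β * (⌊u⌋ : ℝ) * Complex.I) * K (u - ⌊u⌋))
    {y : ℝ} (hy : y ∈ Ioo (-(1 / 2 : ℝ)) (-(1 / 4 : ℝ))) :
    G ((1 / 4 : ℝ) - y) * Complex.exp (((2 * Real.pi * ξ * y : ℝ) : ℂ) * Complex.I) * Complex.exp (-((2 * Real.pi * a * s * triWave y : ℝ) : ℂ) * Complex.I) =
      Complex.exp (((Real.pi * a * s : ℝ) : ℂ) * Complex.I) *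
        ((((1 : ℂ) * (-1 / ((1 - starRingEnd ℂ (Complex.exp (2 * Real.pi * β * Complex.I)) * (Real.exp (-(2 * Real.pi * a)) : ℂ)) * (2 * (2 * Real.pi * a)))) * Complex.exp (-((2 * Real.pi * a : ℝ) : ℂ) * (1 / 4 : ℝ))) * Complex.exp (((2 * Real.pi * a : ℝ) : ℂ) * y) +
          ((1 : ℂ) * (-(Complex.exp (2 * Real.pi * β * Complex.I) * (Real.exp (-(2 * Real.pi * a)) : ℂ)) / ((1 - Complex.exp (2 * Real.pi * β * Complex.I) * (Real.exp (-(2 * Real.pi * a)) : ℂ)) * (2 * (2 * Real.pi * a)))) * Complex.exp (((2 * Real.pi * a : ℝ) : ℂ) * (1 / 4 : ℝ))) * Complex.exp (-((2 * Real.pi * a : ℝ) : ℂ) * y)) *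
          Complex.exp ((((2 * Real.pi * (ξ + a * s) : ℝ)) : ℂ) * y * Complex.I)) := by
  have hfl : ⌊(1 / 4 : ℝ) - y⌋ = 0 := floor_eq_zero_of_mem (by linarith [hy.1, hy.2]) (by linarith [hy.1, hy.2])
  have hT : triWave y = -(1 / 2) - y := triWave_eq_neg_half_sub (by linarith [hy.1, hy.2]) (by linarith [hy.1, hy.2])
  rw [hG, hfl, hT, show (1 / 4 : ℝ) - y - ((0 : ℤ) : ℝ) = (1 / 4 : ℝ) - y by push_cast; ring, lineKernel_twoExp ha β hK]
  have e0 : Complex.exp (2 * Real.pi * β * (((0 : ℤ)) : ℝ) * Complex.I) = (1 : ℂ) := by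
    simp
  have e1 : Complex.exp (-((2 * Real.pi * a : ℝ) : ℂ) * ((((1 / 4 : ℝ) - y : ℝ)) : ℂ)) = Complex.exp (-((2 * Real.pi * a : ℝ) : ℂ) * (1 / 4 : ℝ)) * Complex.exp (((2 * Real.pi * a : ℝ) : ℂ) * y) := by
    rw [← Complex.exp_add]; congr 1; push_cast; ring
  have e2 : Complex.exp (((2 * Real.pi * a : ℝ) : ℂ) * ((((1 / 4 : ℝ) - y : ℝ)) : ℂ)) = Complex.exp (((2 * Real.pi * a : ℝ) : ℂ) * (1 / 4 : ℝ)) * Complex.exp (-((2 * Real.pi * a : ℝ) : ℂ) * y) := by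
    rw [← Complex.exp_add]; congr 1; push_cast; ring
  have e3 : Complex.exp (((2 * Real.pi * ξ * y : ℝ) : ℂ) * Complex.I) * Complex.exp (-((2 * Real.pi * a * s * ((-(1 / 2) - y)) : ℝ) : ℂ) * Complex.I) =
      Complex.exp (((Real.pi * a * s : ℝ) : ℂ) * Complex.I) * Complex.exp ((((2 * Real.pi * (ξ + a * s) : ℝ)) : ℂ) * y * Complex.I) := by
    rw [← Complex.exp_add, ← Complex.exp_add]; congr 1; push_cast; ring
  rw [e0, e1, e2]
  simp only [mul_assoc] at e3 ⊢
  rw [e3]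
  ring


/-- Piece `quarter_centre`: on `Ioo (-(1 / 4 : ℝ)) (1 / 4 : ℝ)` the single-mode forcing integrand at the kink line `y₀ = (1 / 4 : ℝ)` is an explicit two-exponential times a
linear phase (floor of `y₀ − y` is `0`, `triWave` is linear there). [cite: Drazin2002, §8.3 (8.36)–(8.38)] -/
theorem forcingIntegrand_quarter_centre (ha : 0 < a) (β ξ s : ℝ)
    (hK : K = fun r : ℝ => (-((Real.exp (-(2 * Real.pi * a * r)) : ℂ) /
            (1 - starRingEnd ℂ (Complex.exp (2 * Real.pi * β * Complex.I)) * (Real.exp (-(2 * Real.pi * a)) : ℂ))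
          + (Real.exp (2 * Real.pi * a * (r - 1)) : ℂ) * Complex.exp (2 * Real.pi * β * Complex.I) /
            (1 - Complex.exp (2 * Real.pi * β * Complex.I) * (Real.exp (-(2 * Real.pi * a)) : ℂ))) /
        (2 * (2 * Real.pi * a) : ℂ)))
    (hG : ∀ u : ℝ, G u = Complex.exp (2 * Real.pi * β * (⌊u⌋ : ℝ) * Complex.I) * K (u - ⌊u⌋))
    {y : ℝ} (hy : y ∈ Ioo (-(1 / 4 : ℝ)) (1 / 4 : ℝ)) :
    G ((1 / 4 : ℝ) - y) * Complex.exp (((2 * Real.pi * ξ * y : ℝ) : ℂ) * Complex.I) * Complex.exp (-((2 * Real.pi * a * s * triWave y : ℝ) : ℂ) * Complex.I) =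
      (1 : ℂ) *
        ((((1 : ℂ) * (-1 / ((1 - starRingEnd ℂ (Complex.exp (2 * Real.pi * β * Complex.I)) * (Real.exp (-(2 * Real.pi * a)) : ℂ)) * (2 * (2 * Real.pi * a)))) * Complex.exp (-((2 * Real.pi * a : ℝ) : ℂ) * (1 / 4 : ℝ))) * Complex.exp (((2 * Real.pi * a : ℝ) : ℂ) * y) +
          ((1 : ℂ) * (-(Complex.exp (2 * Real.pi * β * Complex.I) * (Real.exp (-(2 * Real.pi * a)) : ℂ)) / ((1 - Complex.exp (2 * Real.pi * β * Complex.I) * (Real.exp (-(2 * Real.pi * a)) : ℂ)) * (2 * (2 * Real.pi * a)))) * Complex.exp (((2 * Real.pi * a : ℝ) : ℂ) * (1 / 4 : ℝ))) * Complex.exp (-((2 * Real.pi * a : ℝ) : ℂ) * y)) *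
          Complex.exp ((((2 * Real.pi * (ξ - a * s) : ℝ)) : ℂ) * y * Complex.I)) := by
  have hfl : ⌊(1 / 4 : ℝ) - y⌋ = 0 := floor_eq_zero_of_mem (by linarith [hy.1, hy.2]) (by linarith [hy.1, hy.2])
  have hT : triWave y = y := triWave_eq_self (by linarith [hy.1, hy.2]) (by linarith [hy.1, hy.2])
  rw [hG, hfl, hT, show (1 / 4 : ℝ) - y - ((0 : ℤ) : ℝ) = (1 / 4 : ℝ) - y by push_cast; ring, lineKernel_twoExp ha β hK]
  have e0 : Complex.exp (2 * Real.pi * β * (((0 : ℤ)) : ℝ) * Complex.I) = (1 : ℂ) := by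
    simp
  have e1 : Complex.exp (-((2 * Real.pi * a : ℝ) : ℂ) * ((((1 / 4 : ℝ) - y : ℝ)) : ℂ)) = Complex.exp (-((2 * Real.pi * a : ℝ) : ℂ) * (1 / 4 : ℝ)) * Complex.exp (((2 * Real.pi * a : ℝ) : ℂ) * y) := by
    rw [← Complex.exp_add]; congr 1; push_cast; ring
  have e2 : Complex.exp (((2 * Real.pi * a : ℝ) : ℂ) * ((((1 / 4 : ℝ) - y : ℝ)) : ℂ)) = Complex.exp (((2 * Real.pi * a : ℝ) : ℂ) * (1 / 4 : ℝ)) * Complex.exp (-((2 * Real.pi * a : ℝ) : ℂ) * y) := by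
    rw [← Complex.exp_add]; congr 1; push_cast; ring
  have e3 : Complex.exp (((2 * Real.pi * ξ * y : ℝ) : ℂ) * Complex.I) * Complex.exp (-((2 * Real.pi * a * s * (y) : ℝ) : ℂ) * Complex.I) =
      Complex.exp ((((2 * Real.pi * (ξ - a * s) : ℝ)) : ℂ) * y * Complex.I) := by
    rw [← Complex.exp_add]; congr 1; push_cast; ring
  rw [e0, e1, e2]
  simp only [mul_assoc] at e3 ⊢
  rw [e3]
  ring


/-- Piece `quarter_crest`: on `Ioo (1 / 4 : ℝ) (1 / 2 : ℝ)` the single-mode forcing integrand at the kink line `y₀ = (1 / 4 : ℝ)` is an explicit two-exponential times a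
linear phase (floor of `y₀ − y` is `-1`, `triWave` is linear there). [cite: Drazin2002, §8.3 (8.36)–(8.38)] -/
theorem forcingIntegrand_quarter_crest (ha : 0 < a) (β ξ s : ℝ)
    (hK : K = fun r : ℝ => (-((Real.exp (-(2 * Real.pi * a * r)) : ℂ) /
            (1 - starRingEnd ℂ (Complex.exp (2 * Real.pi * β * Complex.I)) * (Real.exp (-(2 * Real.pi * a)) : ℂ))
          + (Real.exp (2 * Real.pi * a * (r - 1)) : ℂ) * Complex.exp (2 * Real.pi * β * Complex.I) /
            (1 - Complex.exp (2 * Real.pi * β * Complex.I) * (Real.exp (-(2 * Real.pi * a)) : ℂ))) /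
        (2 * (2 * Real.pi * a) : ℂ)))
    (hG : ∀ u : ℝ, G u = Complex.exp (2 * Real.pi * β * (⌊u⌋ : ℝ) * Complex.I) * K (u - ⌊u⌋))
    {y : ℝ} (hy : y ∈ Ioo (1 / 4 : ℝ) (1 / 2 : ℝ)) :
    G ((1 / 4 : ℝ) - y) * Complex.exp (((2 * Real.pi * ξ * y : ℝ) : ℂ) * Complex.I) * Complex.exp (-((2 * Real.pi * a * s * triWave y : ℝ) : ℂ) * Complex.I) =
      Complex.exp (-((Real.pi * a * s : ℝ) : ℂ) * Complex.I) *
        ((((starRingEnd ℂ (Complex.exp (2 * Real.pi * β * Complex.I))) * (-1 / ((1 - starRingEnd ℂ (Complex.exp (2 * Real.pi * β * Complex.I)) * (Real.exp (-(2 * Real.pi * a)) : ℂ)) * (2 * (2 * Real.pi * a)))) * Complex.exp (-((2 * Real.pi * a : ℝ) : ℂ) * (5 / 4 : ℝ))) * Complex.exp (((2 * Real.pi * a : ℝ) : ℂ) * y) +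
          ((starRingEnd ℂ (Complex.exp (2 * Real.pi * β * Complex.I))) * (-(Complex.exp (2 * Real.pi * β * Complex.I) * (Real.exp (-(2 * Real.pi * a)) : ℂ)) / ((1 - Complex.exp (2 * Real.pi * β * Complex.I) * (Real.exp (-(2 * Real.pi * a)) : ℂ)) * (2 * (2 * Real.pi * a)))) * Complex.exp (((2 * Real.pi * a : ℝ) : ℂ) * (5 / 4 : ℝ))) * Complex.exp (-((2 * Real.pi * a : ℝ) : ℂ) * y)) *
          Complex.exp ((((2 * Real.pi * (ξ + a * s) : ℝ)) : ℂ) * y * Complex.I)) := by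
  have hfl : ⌊(1 / 4 : ℝ) - y⌋ = -1 := floor_eq_neg_one_of_mem (by linarith [hy.1, hy.2]) (by linarith [hy.1, hy.2])
  have hT : triWave y = 1 / 2 - y := triWave_eq_half_sub (by linarith [hy.1, hy.2]) (by linarith [hy.1, hy.2])
  rw [hG, hfl, hT, show (1 / 4 : ℝ) - y - ((-1 : ℤ) : ℝ) = (5 / 4 : ℝ) - y by push_cast; ring, lineKernel_twoExp ha β hK]
  have e0 : Complex.exp (2 * Real.pi * β * (((-1 : ℤ)) : ℝ) * Complex.I) = (starRingEnd ℂ (Complex.exp (2 * Real.pi * β * Complex.I))) := by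
    rw [← Complex.exp_conj]; congr 1; simp only [map_mul, map_ofNat, Complex.conj_ofReal, Complex.conj_I]; push_cast; ring
  have e1 : Complex.exp (-((2 * Real.pi * a : ℝ) : ℂ) * ((((5 / 4 : ℝ) - y : ℝ)) : ℂ)) = Complex.exp (-((2 * Real.pi * a : ℝ) : ℂ) * (5 / 4 : ℝ)) * Complex.exp (((2 * Real.pi * a : ℝ) : ℂ) * y) := by
    rw [← Complex.exp_add]; congr 1; push_cast; ring
  have e2 : Complex.exp (((2 * Real.pi * a : ℝ) : ℂ) * ((((5 / 4 : ℝ) - y : ℝ)) : ℂ)) = Complex.exp (((2 * Real.pi * a : ℝ) : ℂ) * (5 / 4 : ℝ)) * Complex.exp (-((2 * Real.pi * a : ℝ) : ℂ) * y) := by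
    rw [← Complex.exp_add]; congr 1; push_cast; ring
  have e3 : Complex.exp (((2 * Real.pi * ξ * y : ℝ) : ℂ) * Complex.I) * Complex.exp (-((2 * Real.pi * a * s * ((1 / 2 - y)) : ℝ) : ℂ) * Complex.I) =
      Complex.exp (-((Real.pi * a * s : ℝ) : ℂ) * Complex.I) * Complex.exp ((((2 * Real.pi * (ξ + a * s) : ℝ)) : ℂ) * y * Complex.I) := by
    rw [← Complex.exp_add, ← Complex.exp_add]; congr 1; push_cast; ring
  rw [e0, e1, e2]
  simp only [mul_assoc] at e3 ⊢
  rw [e3]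
  ring


/-- Piece `negQuarter_trough`: on `Ioo (-(1 / 2 : ℝ)) (-(1 / 4 : ℝ))` the single-mode forcing integrand at the kink line `y₀ = (-(1 / 4 : ℝ))` is an explicit two-exponential times a
linear phase (floor of `y₀ − y` is `0`, `triWave` is linear there). [cite: Drazin2002, §8.3 (8.36)–(8.38)] -/
theorem forcingIntegrand_negQuarter_trough (ha : 0 < a) (β ξ s : ℝ)
    (hK : K = fun r : ℝ => (-((Real.exp (-(2 * Real.pi * a * r)) : ℂ) /
            (1 - starRingEnd ℂ (Complex.exp (2 * Real.pi * β * Complex.I)) * (Real.exp (-(2 * Real.pi * a)) : ℂ))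
          + (Real.exp (2 * Real.pi * a * (r - 1)) : ℂ) * Complex.exp (2 * Real.pi * β * Complex.I) /
            (1 - Complex.exp (2 * Real.pi * β * Complex.I) * (Real.exp (-(2 * Real.pi * a)) : ℂ))) /
        (2 * (2 * Real.pi * a) : ℂ)))
    (hG : ∀ u : ℝ, G u = Complex.exp (2 * Real.pi * β * (⌊u⌋ : ℝ) * Complex.I) * K (u - ⌊u⌋))
    {y : ℝ} (hy : y ∈ Ioo (-(1 / 2 : ℝ)) (-(1 / 4 : ℝ))) :
    G ((-(1 / 4 : ℝ)) - y) * Complex.exp (((2 * Real.pi * ξ * y : ℝ) : ℂ) * Complex.I) * Complex.exp (-((2 * Real.pi * a * s * triWave y : ℝ) : ℂ) * Complex.I) =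
      Complex.exp (((Real.pi * a * s : ℝ) : ℂ) * Complex.I) *
        ((((1 : ℂ) * (-1 / ((1 - starRingEnd ℂ (Complex.exp (2 * Real.pi * β * Complex.I)) * (Real.exp (-(2 * Real.pi * a)) : ℂ)) * (2 * (2 * Real.pi * a)))) * Complex.exp (-((2 * Real.pi * a : ℝ) : ℂ) * (-(1 / 4 : ℝ)))) * Complex.exp (((2 * Real.pi * a : ℝ) : ℂ) * y) +
          ((1 : ℂ) * (-(Complex.exp (2 * Real.pi * β * Complex.I) * (Real.exp (-(2 * Real.pi * a)) : ℂ)) / ((1 - Complex.exp (2 * Real.pi * β * Complex.I) * (Real.exp (-(2 * Real.pi * a)) : ℂ)) * (2 * (2 * Real.pi * a)))) * Complex.exp (((2 * Real.pi * a : ℝ) : ℂ) * (-(1 / 4 : ℝ)))) * Complex.exp (-((2 * Real.pi * a : ℝ) : ℂ) * y)) *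
          Complex.exp ((((2 * Real.pi * (ξ + a * s) : ℝ)) : ℂ) * y * Complex.I)) := by
  have hfl : ⌊(-(1 / 4 : ℝ)) - y⌋ = 0 := floor_eq_zero_of_mem (by linarith [hy.1, hy.2]) (by linarith [hy.1, hy.2])
  have hT : triWave y = -(1 / 2) - y := triWave_eq_neg_half_sub (by linarith [hy.1, hy.2]) (by linarith [hy.1, hy.2])
  rw [hG, hfl, hT, show (-(1 / 4 : ℝ)) - y - ((0 : ℤ) : ℝ) = (-(1 / 4 : ℝ)) - y by push_cast; ring, lineKernel_twoExp ha β hK]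
  have e0 : Complex.exp (2 * Real.pi * β * (((0 : ℤ)) : ℝ) * Complex.I) = (1 : ℂ) := by
    simp
  have e1 : Complex.exp (-((2 * Real.pi * a : ℝ) : ℂ) * ((((-(1 / 4 : ℝ)) - y : ℝ)) : ℂ)) = Complex.exp (-((2 * Real.pi * a : ℝ) : ℂ) * (-(1 / 4 : ℝ))) * Complex.exp (((2 * Real.pi * a : ℝ) : ℂ) * y) := by
    rw [← Complex.exp_add]; congr 1; push_cast; ring
  have e2 : Complex.exp (((2 * Real.pi * a : ℝ) : ℂ) * ((((-(1 / 4 : ℝ)) - y : ℝ)) : ℂ)) = Complex.exp (((2 * Real.pi * a : ℝ) : ℂ) * (-(1 / 4 : ℝ))) * Complex.exp (-((2 * Real.pi * a : ℝ) : ℂ) * y) := by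
    rw [← Complex.exp_add]; congr 1; push_cast; ring
  have e3 : Complex.exp (((2 * Real.pi * ξ * y : ℝ) : ℂ) * Complex.I) * Complex.exp (-((2 * Real.pi * a * s * ((-(1 / 2) - y)) : ℝ) : ℂ) * Complex.I) =
      Complex.exp (((Real.pi * a * s : ℝ) : ℂ) * Complex.I) * Complex.exp ((((2 * Real.pi * (ξ + a * s) : ℝ)) : ℂ) * y * Complex.I) := by
    rw [← Complex.exp_add, ← Complex.exp_add]; congr 1; push_cast; ring
  rw [e0, e1, e2]
  simp only [mul_assoc] at e3 ⊢
  rw [e3]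
  ring


/-- Piece `negQuarter_centre`: on `Ioo (-(1 / 4 : ℝ)) (1 / 4 : ℝ)` the single-mode forcing integrand at the kink line `y₀ = (-(1 / 4 : ℝ))` is an explicit two-exponential times a
linear phase (floor of `y₀ − y` is `-1`, `triWave` is linear there). [cite: Drazin2002, §8.3 (8.36)–(8.38)] -/
theorem forcingIntegrand_negQuarter_centre (ha : 0 < a) (β ξ s : ℝ)
    (hK : K = fun r : ℝ => (-((Real.exp (-(2 * Real.pi * a * r)) : ℂ) /
            (1 - starRingEnd ℂ (Complex.exp (2 * Real.pi * β * Complex.I)) * (Real.exp (-(2 * Real.pi * a)) : ℂ))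
          + (Real.exp (2 * Real.pi * a * (r - 1)) : ℂ) * Complex.exp (2 * Real.pi * β * Complex.I) /
            (1 - Complex.exp (2 * Real.pi * β * Complex.I) * (Real.exp (-(2 * Real.pi * a)) : ℂ))) /
        (2 * (2 * Real.pi * a) : ℂ)))
    (hG : ∀ u : ℝ, G u = Complex.exp (2 * Real.pi * β * (⌊u⌋ : ℝ) * Complex.I) * K (u - ⌊u⌋))
    {y : ℝ} (hy : y ∈ Ioo (-(1 / 4 : ℝ)) (1 / 4 : ℝ)) :
    G ((-(1 / 4 : ℝ)) - y) * Complex.exp (((2 * Real.pi * ξ * y : ℝ) : ℂ) * Complex.I) * Complex.exp (-((2 * Real.pi * a * s * triWave y : ℝ) : ℂ) * Complex.I) =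
      (1 : ℂ) *
        ((((starRingEnd ℂ (Complex.exp (2 * Real.pi * β * Complex.I))) * (-1 / ((1 - starRingEnd ℂ (Complex.exp (2 * Real.pi * β * Complex.I)) * (Real.exp (-(2 * Real.pi * a)) : ℂ)) * (2 * (2 * Real.pi * a)))) * Complex.exp (-((2 * Real.pi * a : ℝ) : ℂ) * (3 / 4 : ℝ))) * Complex.exp (((2 * Real.pi * a : ℝ) : ℂ) * y) +
          ((starRingEnd ℂ (Complex.exp (2 * Real.pi * β * Complex.I))) * (-(Complex.exp (2 * Real.pi * β * Complex.I) * (Real.exp (-(2 * Real.pi * a)) : ℂ)) / ((1 - Complex.exp (2 * Real.pi * β * Complex.I) * (Real.exp (-(2 * Real.pi * a)) : ℂ)) * (2 * (2 * Real.pi * a)))) * Complex.exp (((2 * Real.pi * a : ℝ) : ℂ) * (3 / 4 : ℝ))) * Complex.exp (-((2 * Real.pi * a : ℝ) : ℂ) * y)) *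
          Complex.exp ((((2 * Real.pi * (ξ - a * s) : ℝ)) : ℂ) * y * Complex.I)) := by
  have hfl : ⌊(-(1 / 4 : ℝ)) - y⌋ = -1 := floor_eq_neg_one_of_mem (by linarith [hy.1, hy.2]) (by linarith [hy.1, hy.2])
  have hT : triWave y = y := triWave_eq_self (by linarith [hy.1, hy.2]) (by linarith [hy.1, hy.2])
  rw [hG, hfl, hT, show (-(1 / 4 : ℝ)) - y - ((-1 : ℤ) : ℝ) = (3 / 4 : ℝ) - y by push_cast; ring, lineKernel_twoExp ha β hK]
  have e0 : Complex.exp (2 * Real.pi * β * (((-1 : ℤ)) : ℝ) * Complex.I) = (starRingEnd ℂ (Complex.exp (2 * Real.pi * β * Complex.I))) := by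
    rw [← Complex.exp_conj]; congr 1; simp only [map_mul, map_ofNat, Complex.conj_ofReal, Complex.conj_I]; push_cast; ring
  have e1 : Complex.exp (-((2 * Real.pi * a : ℝ) : ℂ) * ((((3 / 4 : ℝ) - y : ℝ)) : ℂ)) = Complex.exp (-((2 * Real.pi * a : ℝ) : ℂ) * (3 / 4 : ℝ)) * Complex.exp (((2 * Real.pi * a : ℝ) : ℂ) * y) := by
    rw [← Complex.exp_add]; congr 1; push_cast; ring
  have e2 : Complex.exp (((2 * Real.pi * a : ℝ) : ℂ) * ((((3 / 4 : ℝ) - y : ℝ)) : ℂ)) = Complex.exp (((2 * Real.pi * a : ℝ) : ℂ) * (3 / 4 : ℝ)) * Complex.exp (-((2 * Real.pi * a : ℝ) : ℂ) * y) := by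
    rw [← Complex.exp_add]; congr 1; push_cast; ring
  have e3 : Complex.exp (((2 * Real.pi * ξ * y : ℝ) : ℂ) * Complex.I) * Complex.exp (-((2 * Real.pi * a * s * (y) : ℝ) : ℂ) * Complex.I) =
      Complex.exp ((((2 * Real.pi * (ξ - a * s) : ℝ)) : ℂ) * y * Complex.I) := by
    rw [← Complex.exp_add]; congr 1; push_cast; ring
  rw [e0, e1, e2]
  simp only [mul_assoc] at e3 ⊢
  rw [e3]
  ring


/-- Piece `negQuarter_crest`: on `Ioo (1 / 4 : ℝ) (1 / 2 : ℝ)` the single-mode forcing integrand at the kink line `y₀ = (-(1 / 4 : ℝ))` is an explicit two-exponential times a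
linear phase (floor of `y₀ − y` is `-1`, `triWave` is linear there). [cite: Drazin2002, §8.3 (8.36)–(8.38)] -/
theorem forcingIntegrand_negQuarter_crest (ha : 0 < a) (β ξ s : ℝ)
    (hK : K = fun r : ℝ => (-((Real.exp (-(2 * Real.pi * a * r)) : ℂ) /
            (1 - starRingEnd ℂ (Complex.exp (2 * Real.pi * β * Complex.I)) * (Real.exp (-(2 * Real.pi * a)) : ℂ))
          + (Real.exp (2 * Real.pi * a * (r - 1)) : ℂ) * Complex.exp (2 * Real.pi * β * Complex.I) /
            (1 - Complex.exp (2 * Real.pi * β * Complex.I) * (Real.exp (-(2 * Real.pi * a)) : ℂ))) /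
        (2 * (2 * Real.pi * a) : ℂ)))
    (hG : ∀ u : ℝ, G u = Complex.exp (2 * Real.pi * β * (⌊u⌋ : ℝ) * Complex.I) * K (u - ⌊u⌋))
    {y : ℝ} (hy : y ∈ Ioo (1 / 4 : ℝ) (1 / 2 : ℝ)) :
    G ((-(1 / 4 : ℝ)) - y) * Complex.exp (((2 * Real.pi * ξ * y : ℝ) : ℂ) * Complex.I) * Complex.exp (-((2 * Real.pi * a * s * triWave y : ℝ) : ℂ) * Complex.I) =
      Complex.exp (-((Real.pi * a * s : ℝ) : ℂ) * Complex.I) *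
        ((((starRingEnd ℂ (Complex.exp (2 * Real.pi * β * Complex.I))) * (-1 / ((1 - starRingEnd ℂ (Complex.exp (2 * Real.pi * β * Complex.I)) * (Real.exp (-(2 * Real.pi * a)) : ℂ)) * (2 * (2 * Real.pi * a)))) * Complex.exp (-((2 * Real.pi * a : ℝ) : ℂ) * (3 / 4 : ℝ))) * Complex.exp (((2 * Real.pi * a : ℝ) : ℂ) * y) +
          ((starRingEnd ℂ (Complex.exp (2 * Real.pi * β * Complex.I))) * (-(Complex.exp (2 * Real.pi * β * Complex.I) * (Real.exp (-(2 * Real.pi * a)) : ℂ)) / ((1 - Complex.exp (2 * Real.pi * β * Complex.I) * (Real.exp (-(2 * Real.pi * a)) : ℂ)) * (2 * (2 * Real.pi * a)))) * Complex.exp (((2 * Real.pi * a : ℝ) : ℂ) * (3 / 4 : ℝ))) * Complex.exp (-((2 * Real.pi * a : ℝ) : ℂ) * y)) *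
          Complex.exp ((((2 * Real.pi * (ξ + a * s) : ℝ)) : ℂ) * y * Complex.I)) := by
  have hfl : ⌊(-(1 / 4 : ℝ)) - y⌋ = -1 := floor_eq_neg_one_of_mem (by linarith [hy.1, hy.2]) (by linarith [hy.1, hy.2])
  have hT : triWave y = 1 / 2 - y := triWave_eq_half_sub (by linarith [hy.1, hy.2]) (by linarith [hy.1, hy.2])
  rw [hG, hfl, hT, show (-(1 / 4 : ℝ)) - y - ((-1 : ℤ) : ℝ) = (3 / 4 : ℝ) - y by push_cast; ring, lineKernel_twoExp ha β hK]
  have e0 : Complex.exp (2 * Real.pi * β * (((-1 : ℤ)) : ℝ) * Complex.I) = (starRingEnd ℂ (Complex.exp (2 * Real.pi * β * Complex.I))) := by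
    rw [← Complex.exp_conj]; congr 1; simp only [map_mul, map_ofNat, Complex.conj_ofReal, Complex.conj_I]; push_cast; ring
  have e1 : Complex.exp (-((2 * Real.pi * a : ℝ) : ℂ) * ((((3 / 4 : ℝ) - y : ℝ)) : ℂ)) = Complex.exp (-((2 * Real.pi * a : ℝ) : ℂ) * (3 / 4 : ℝ)) * Complex.exp (((2 * Real.pi * a : ℝ) : ℂ) * y) := by
    rw [← Complex.exp_add]; congr 1; push_cast; ring
  have e2 : Complex.exp (((2 * Real.pi * a : ℝ) : ℂ) * ((((3 / 4 : ℝ) - y : ℝ)) : ℂ)) = Complex.exp (((2 * Real.pi * a : ℝ) : ℂ) * (3 / 4 : ℝ)) * Complex.exp (-((2 * Real.pi * a : ℝ) : ℂ) * y) := by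
    rw [← Complex.exp_add]; congr 1; push_cast; ring
  have e3 : Complex.exp (((2 * Real.pi * ξ * y : ℝ) : ℂ) * Complex.I) * Complex.exp (-((2 * Real.pi * a * s * ((1 / 2 - y)) : ℝ) : ℂ) * Complex.I) =
      Complex.exp (-((Real.pi * a * s : ℝ) : ℂ) * Complex.I) * Complex.exp ((((2 * Real.pi * (ξ + a * s) : ℝ)) : ℂ) * y * Complex.I) := by
    rw [← Complex.exp_add, ← Complex.exp_add]; congr 1; push_cast; ring
  rw [e0, e1, e2]
  simp only [mul_assoc] at e3 ⊢
  rw [e3]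
  ring


end forcing

end Summit.AnomalousDissipation.AnomalousDissipation.Theorems.SawtoothPulseCascade.K2PhaseBudget

end
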